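import Mathlib
import Summits.Ventures.HodgeRepro.Tier4.Common.AdelicRTF
import Summits.Ventures.HodgeRepro.Tier4.Common.AdelicHaar
import Summits.Ventures.HodgeRepro.Tier4.Common.LocalTorus
import Summits.Ventures.HodgeRepro.Tier4.Common.LocalTorusCompact
import Summits.Ventures.HodgeRepro.Tier4.Common.MixedPlaneCusp
import Summits.Ventures.HodgeRepro.Tier4.Line1.FiniteLevelIsolation
import Summits.Ventures.HodgeRepro.Tier4.Line1.LocallyCompactGA
import Summits.Ventures.HodgeRepro.Tier4.Line1.SecondCountableGA
import Summits.Ventures.HodgeRepro.Tier4.Line4.FinitePlacePositivity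
import Summits.Ventures.HodgeRepro.Tier4.Line4.OrbitalUnfold
import Summits.Ventures.HodgeRepro.Tier4.Line4.FinitePartClosed
import Summits.Ventures.HodgeRepro.Tier4.Line4.TorusProduct

/-!
# Tier4/Line4/InnerSplit — C-L4-INNERSPLIT: the inner `T′(𝔸)`-integral of a product test function splits

Blind re-derivation cell `pub-hodge-repro`, Tier 4 «prove the step» (README §9–§10), seat t4-L4-p2 (prover, LINE L4,
gen 3; plan-4 g3's factorisation chain S14430, Part 2; statements VERBATIM from
proofs/t4-plan-4/work/Factorisation-STATEMENTS.lean ab4f458871758c99 — Part 0 (TORUSPROD v2) and Part 1 (the PARTS laws)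
are imported from L2-p1's `Line4.TorusProduct`). Tree path `lean/Summits/Ventures/HodgeRepro/Tier4/Line4/InnerSplit.lean`.
Mathlib-level; no literature.

For a PRODUCT test function `F g = F_∞(g_∞) F_f(g_f)` and `μ_{T′} = c′ · (ν_∞ ⊗ ν_f)` transported through
`torusSplit' : T′(𝔸) ≃ₜ* T′_∞ × T′_f`, the inner integral of `OrbitalUnfold`'s `innerFull` factors:
`innerFull F γ₀ t = c′ · I_∞(t_∞) · I_f(t_f)` with `I_∞ = innerInf`, `I_f = innerFin` — `χ′(ab) = χ′(a)χ′(b)` is the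
`RTFData` field `chi'_mul`, the parts are multiplicative (`ofInfPart_mul`, `ofFinPart_mul`), an archimedean element has
trivial finite part and conversely, and Fubini on `ν_∞ ⊗ ν_f` is Mathlib's `integral_prod_mul` (the factor tori are
closed in `T′(𝔸)`, hence locally compact and σ-compact, so their Haar measures are σ-finite: `isClosed_torusInf'`,
`isClosed_torusFin'`, from `FinitePartClosed`). The integrability hypotheses `hA`, `hB` are
not needed for the identity itself (`integral_prod_mul` is unconditional); they give `Integrable (innerFn …) μ_{T′}`
(`integrable_innerFn_of_prod`), which Part 4 (PRODINT) consumes.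

Nothing here says anything about the status of the Hodge conjecture for CM abelian varieties, which is NOT proved
(HC_CM is NOT proved by anyone in this repository).
-/

set_option autoImplicit false
noncomputable section
namespace Summit.Ventures.HodgeRepro.Tier4.Line4
open Summit.Ventures.HodgeRepro.Tier4 Summit.Ventures.HodgeRepro.Tier4.Common
  Summit.Ventures.HodgeRepro.Tier4.Line1 MeasureTheory
open scoped ComplexConjugate Topology Pointwise NNReal

/-! ## Closedness of the factor tori (from `FinitePartClosed`) -/

section InnerSplitHelpers
variable {k : Type} [Field k] [NumberField k] (W : PlaneData k)

/-- `T′_∞` is closed in `T′(𝔸_k)`. -/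
theorem isClosed_torusInf' : IsClosed ((torusInf' W : Set (torusT' W))) :=
  isClosed_subgroupOf_infinitePart W (torusT' W)

/-- `T′_f` is closed in `T′(𝔸_k)`. -/
theorem isClosed_torusFin' : IsClosed ((torusFin' W : Set (torusT' W))) :=
  isClosed_subgroupOf_finitePart W (torusT' W)

end InnerSplitHelpers

/-! ## Part 2 — C-L4-INNERSPLIT -/

section InnerSplit
variable {k : Type} [Field k] [NumberField k] (W : PlaneData k)
  [MeasurableSpace (torusT W)] [MeasurableSpace (torusT' W)] (R : RTFData W)

/-- **The archimedean inner integral** `I_∞(a₀) = ∫_{T′_∞} conj χ′(a) F_∞(a₀⁻¹ γ₀,∞ a) dν_∞`. -/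
def innerInf (Finf : GA W → ℂ) (γ₀ : GA W) (νinf : Measure (torusInf' W)) (a₀ : torusInf W) : ℂ :=
  ∫ a, conj (R.chi' (a : torusT' W)) *
    Finf ((((a₀ : torusT W) : GA W))⁻¹ * GA.ofInfPart W γ₀ * ((a : torusT' W) : GA W)) ∂νinf

/-- **The finite inner integral** `I_f(b₀) = ∫_{T′_f} conj χ′(b) F_f(b₀⁻¹ γ₀,f b) dν_f`. -/
def innerFin (Ffin : GA W → ℂ) (γ₀ : GA W) (νf : Measure (torusFin' W)) (b₀ : torusFin W) : ℂ :=
  ∫ b, conj (R.chi' (b : torusT' W)) *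
    Ffin ((((b₀ : torusT W) : GA W))⁻¹ * GA.ofFinPart W γ₀ * ((b : torusT' W) : GA W)) ∂νf


/-- **The integrand of `innerFull` on `T′_∞ × T′_f`, pointwise**: for a product test function,
`innerFn F γ₀ t (a b) = [conj χ′(a) F_∞(t_∞⁻¹ γ₀,∞ a)] · [conj χ′(b) F_f(t_f⁻¹ γ₀,f b)]`. -/
theorem innerFn_torusSplit'_symm_of_prod (F Finf Ffin : GA W → ℂ)
    (hF : ∀ g, F g = Finf (GA.ofInfPart W g) * Ffin (GA.ofFinPart W g)) (γ₀ : GA W) (t : torusT W)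
    (p : torusInf' W × torusFin' W) :
    innerFn W R F γ₀ t ((torusSplit' W).symm p) =
      (conj (R.chi' (p.1 : torusT' W)) *
        Finf ((GA.ofInfPart W t)⁻¹ * GA.ofInfPart W γ₀ * ((p.1 : torusT' W) : GA W))) *
      (conj (R.chi' (p.2 : torusT' W)) *
        Ffin ((GA.ofFinPart W t)⁻¹ * GA.ofFinPart W γ₀ * ((p.2 : torusT' W) : GA W))) := by
  have hsymm : (torusSplit' W).symm p = ((p.1 : torusT' W) * (p.2 : torusT' W)) := rfl
  rw [hsymm, innerFn, RTFData.chi'conj, R.chi'_mul, map_mul, hF, Subgroup.coe_mul]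
  have h1 : GA.ofInfPart W ((t : GA W)⁻¹ * γ₀ * (((p.1 : torusT' W) : GA W) * ((p.2 : torusT' W) : GA W))) =
      (GA.ofInfPart W t)⁻¹ * GA.ofInfPart W γ₀ * ((p.1 : torusT' W) : GA W) := by
    rw [ofInfPart_mul, ofInfPart_mul, ofInfPart_mul, ofInfPart_inv,
      ofInfPart_eq_self_of_mem_infinitePart W (Subgroup.mem_subgroupOf.1 p.1.2),
      ofInfPart_eq_one_of_mem_finitePart W (Subgroup.mem_subgroupOf.1 p.2.2), mul_one]
  have h2 : GA.ofFinPart W ((t : GA W)⁻¹ * γ₀ * (((p.1 : torusT' W) : GA W) * ((p.2 : torusT' W) : GA W))) =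
      (GA.ofFinPart W t)⁻¹ * GA.ofFinPart W γ₀ * ((p.2 : torusT' W) : GA W) := by
    rw [ofFinPart_mul, ofFinPart_mul, ofFinPart_mul, ofFinPart_inv,
      ofFinPart_eq_one_of_mem_infinitePart W (Subgroup.mem_subgroupOf.1 p.1.2),
      ofFinPart_eq_self_of_mem_finitePart W (Subgroup.mem_subgroupOf.1 p.2.2), one_mul]
  rw [h1, h2]
  ring

/-- **Integrability of the inner integrand** for a product test function with integrable factors
(`hA`, `hB`): transported through `torusSplit'`, it is the product function `A(a) B(b)` on `T′_∞ × T′_f`. -/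
theorem integrable_innerFn_of_prod [BorelSpace (torusT' W)]
    (νinf : Measure (torusInf' W)) [νinf.IsHaarMeasure] (νf : Measure (torusFin' W)) [νf.IsHaarMeasure]
    (c' : ℝ≥0) (hc' : R.μT' = c' • Measure.map (torusSplit' W).symm (νinf.prod νf))
    (F Finf Ffin : GA W → ℂ) (hF : ∀ g, F g = Finf (GA.ofInfPart W g) * Ffin (GA.ofFinPart W g))
    (γ₀ : GA W) (t : torusT W)
    (hA : Integrable (fun a : torusInf' W => conj (R.chi' (a : torusT' W)) *
      Finf ((GA.ofInfPart W t)⁻¹ * GA.ofInfPart W γ₀ * ((a : torusT' W) : GA W))) νinf)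
    (hB : Integrable (fun b : torusFin' W => conj (R.chi' (b : torusT' W)) *
      Ffin ((GA.ofFinPart W t)⁻¹ * GA.ofFinPart W γ₀ * ((b : torusT' W) : GA W))) νf) :
    Integrable (innerFn W R F γ₀ t) R.μT' := by
  haveI := locallyCompact_GA W
  haveI := secondCountable_GA W
  haveI := locallyCompactSpace_torusT' W
  haveI : SecondCountableTopology (torusT' W) :=
    TopologicalSpace.Subtype.secondCountableTopology (torusT' W : Set (GA W))
  haveI : SecondCountableTopology (torusInf' W) :=
    TopologicalSpace.Subtype.secondCountableTopology (torusInf' W : Set (torusT' W))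
  haveI : SecondCountableTopology (torusFin' W) :=
    TopologicalSpace.Subtype.secondCountableTopology (torusFin' W : Set (torusT' W))
  haveI : LocallyCompactSpace (torusInf' W) := (isClosed_torusInf' W).locallyCompactSpace
  haveI : LocallyCompactSpace (torusFin' W) := (isClosed_torusFin' W).locallyCompactSpace
  haveI : IsLocallyFiniteMeasure νinf := isLocallyFiniteMeasure_of_isFiniteMeasureOnCompacts
  haveI : IsLocallyFiniteMeasure νf := isLocallyFiniteMeasure_of_isFiniteMeasureOnCompacts
  haveI : SigmaFinite νinf := sigmaFinite_of_locallyFinite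
  haveI : SigmaFinite νf := sigmaFinite_of_locallyFinite
  haveI : BorelSpace (torusInf' W) := Subtype.borelSpace _
  haveI : BorelSpace (torusFin' W) := Subtype.borelSpace _
  haveI : BorelSpace (torusInf' W × torusFin' W) := Prod.borelSpace
  have hemb : MeasurableEmbedding (⇑(torusSplit' W).symm) :=
    (torusSplit' W).symm.toHomeomorph.measurableEmbedding
  rw [hc']
  refine Integrable.smul_measure ?_ ENNReal.coe_ne_top
  rw [hemb.integrable_map_iff]
  refine (hA.mul_prod hB).congr (Filter.Eventually.of_forall fun p => ?_)
  exact (innerFn_torusSplit'_symm_of_prod W R F Finf Ffin hF γ₀ t p).symm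

/-- **C-L4-INNERSPLIT**: for a PRODUCT test function `F g = F_∞(g_∞) F_f(g_f)` and `μ_{T′} = c′ (ν_∞ ⊗ ν_f)`,
`innerFull F γ₀ t = c′ · I_∞(t_∞) · I_f(t_f)` (`χ′(a b) = χ′(a) χ′(b)` is `chi'_mul`; the parts are multiplicative, Part 1;
Fubini `integral_prod_mul`). -/
theorem innerFull_eq_mul_of_prod [BorelSpace (torusT' W)]
    (νinf : Measure (torusInf' W)) [νinf.IsHaarMeasure] (νf : Measure (torusFin' W)) [νf.IsHaarMeasure]
    (c' : ℝ≥0) (hc' : R.μT' = c' • Measure.map (torusSplit' W).symm (νinf.prod νf))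
    (F Finf Ffin : GA W → ℂ) (hF : ∀ g, F g = Finf (GA.ofInfPart W g) * Ffin (GA.ofFinPart W g))
    (γ₀ : GA W) (t : torusT W)
    (hA : Integrable (fun a : torusInf' W => conj (R.chi' (a : torusT' W)) *
      Finf ((GA.ofInfPart W t)⁻¹ * GA.ofInfPart W γ₀ * ((a : torusT' W) : GA W))) νinf)
    (hB : Integrable (fun b : torusFin' W => conj (R.chi' (b : torusT' W)) *
      Ffin ((GA.ofFinPart W t)⁻¹ * GA.ofFinPart W γ₀ * ((b : torusT' W) : GA W))) νf) :
    innerFull W R F γ₀ t = (c' : ℂ) * innerInf W R Finf γ₀ νinf (infTInf W t) * innerFin W R Ffin γ₀ νf (finTf W t) := by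
  haveI := locallyCompact_GA W
  haveI := secondCountable_GA W
  haveI := locallyCompactSpace_torusT' W
  haveI : SecondCountableTopology (torusT' W) :=
    TopologicalSpace.Subtype.secondCountableTopology (torusT' W : Set (GA W))
  haveI : SecondCountableTopology (torusInf' W) :=
    TopologicalSpace.Subtype.secondCountableTopology (torusInf' W : Set (torusT' W))
  haveI : SecondCountableTopology (torusFin' W) :=
    TopologicalSpace.Subtype.secondCountableTopology (torusFin' W : Set (torusT' W))
  haveI : LocallyCompactSpace (torusInf' W) := (isClosed_torusInf' W).locallyCompactSpace
  haveI : LocallyCompactSpace (torusFin' W) := (isClosed_torusFin' W).locallyCompactSpace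
  haveI : IsLocallyFiniteMeasure νinf := isLocallyFiniteMeasure_of_isFiniteMeasureOnCompacts
  haveI : IsLocallyFiniteMeasure νf := isLocallyFiniteMeasure_of_isFiniteMeasureOnCompacts
  haveI : SigmaFinite νinf := sigmaFinite_of_locallyFinite
  haveI : SigmaFinite νf := sigmaFinite_of_locallyFinite
  haveI : BorelSpace (torusInf' W) := Subtype.borelSpace _
  haveI : BorelSpace (torusFin' W) := Subtype.borelSpace _
  haveI : BorelSpace (torusInf' W × torusFin' W) := Prod.borelSpace
  have hemb : MeasurableEmbedding (⇑(torusSplit' W).symm) :=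
    (torusSplit' W).symm.toHomeomorph.measurableEmbedding
  have _hint := integrable_innerFn_of_prod W R νinf νf c' hc' F Finf Ffin hF γ₀ t hA hB
  unfold innerFull
  rw [hc', integral_smul_nnreal_measure, hemb.integral_map]
  simp_rw [innerFn_torusSplit'_symm_of_prod W R F Finf Ffin hF γ₀ t]
  rw [integral_prod_mul (fun a : torusInf' W => conj (R.chi' (a : torusT' W)) *
      Finf ((GA.ofInfPart W t)⁻¹ * GA.ofInfPart W γ₀ * ((a : torusT' W) : GA W)))
    (fun b : torusFin' W => conj (R.chi' (b : torusT' W)) *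
      Ffin ((GA.ofFinPart W t)⁻¹ * GA.ofFinPart W γ₀ * ((b : torusT' W) : GA W))),
    NNReal.smul_def, Complex.real_smul, innerInf, innerFin, mul_assoc]
  rfl


end InnerSplit

end Summit.Ventures.HodgeRepro.Tier4.Line4
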